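import Literature.InformationTheory.QuantumCodes.QuantumExpanderNoisySyndrome
import Summits.Ventures.QEC.Expanders.BiregularExpanderExistence
import HarnessLib

/-!
# Quantum expander codes: the adversarial single-shot guarantee of the small-set-flip decoder on an explicit-size
# family (non-vacuity of FGL18b Cor. 16 in the tree) — PROOF

Index of sources: `[cite: FawziGrospellierLeverrier2018FT]` = Fawzi–Grospellier–Leverrier, FOCS 2018 / arXiv:1808.03821, §3.1
(`β₁ = 1 − 16δ`, `c₀ = 4/(d_A(β₁ − β))`), §3.3 Cor. 16 (p0016 L97 – p0017 L14), §2.3 (p0009 L15-18: "`(γ, δ)`-expanding graph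
with `δ` sufficiently small … we will require the more stringent condition `δ < 1/16`"; Thm. 4: random biregular graphs).

Venture QEC (`Summits/Ventures/QEC/Expanders`), row 04 (`prover-qec-type-04` gen 8), line L-SSF-NOISY. The Literature files
`QuantumExpanderNoisySyndromeDecomposition.lean` / `QuantumExpanderNoisySyndrome.lean` prove FGL18b §3.3 (Lemma 15, Prop. 14,
Cor. 16) and the packaging `ssfDecoder_residual_le_of_syndromeError`: for EVERY small-set-flip decoder of the tree with threshold
`0 < κ < min Δ·β₁/2`, run on ONE noisy syndrome `σ_X(E) ⊕ 𝟙_D`, the residual `E ⊕ Ê` is equivalent modulo `C_Z^⊥` to a word of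
weight `≤ 4|D|/(min Δ·β₁ − 2κ)` as soon as `max Δ·(|E| + (max Δ|E| + |D|)/κ) ≤ min Δ·min(γ_A n_A, γ_B n_B)`. This file shows the
hypotheses are met on a named tree family of every size:

* `exists_biregular_expander_fgl18b` — for all `Δ_A, Δ_B ≥ 17` there are `γ > 0` and `δ = 1/16.5 < 1/16` with
  `(Δ_A,Δ_B)`-biregular `(γ,δ,γ,δ)`-expanders of every size (the tree's `exists_biregular_expander`, random lifts);
* ★ `exists_singleShot_family` — on that family, for every size `n`, BOTH error types, every threshold `0 < κ` with
  `2κ < min Δ·(1 − 16δ)`, every small-set-flip decoder, every qubit error `E` and syndrome error `D` in the stated budget: the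
  residual is equivalent to a word of weight `≤ 4|D|/(min Δ·(1 − 16δ) − 2κ)` — a POSITIVE-RATE LDPC family (`dimension_ge`,
  generators of weight `Δ_A + Δ_B`) with a certified single-shot residual bound linear in the syndrome error, uniformly in `n`.

STATUS: existence form; the bound and its constants are FGL18b's (Cor. 16 at `β = 2κ/min Δ`), the family and the packaging are
the tree's. PROVED (kernel axioms); no definitions, no named facts, 0 kit.
-/

namespace Summit.Ventures.QEC.Expanders

open Finset Matrix Literature.InformationTheory.QuantumCodes Literature.InformationTheory.QuantumCodes.QuantumExpander

/-- **Non-vacuity of the FGL18b hypotheses (`δ < 1/16`)**: for all degrees `Δ_A, Δ_B ≥ 17` there are `γ > 0` and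
`0 < δ < 1/16` (here `δ = 2/33`) such that `(Δ_A,Δ_B)`-biregular `(γ,δ,γ,δ)`-expanders exist for every size — the tree's
random-lift family `exists_biregular_expander` (which needs `δ·Δ > 1`).
[cite: FawziGrospellierLeverrier2018FT, §2.3 (δ < 1/16; Thm 4, random biregular graphs; arXiv p0009 L15-18)] -/
theorem exists_biregular_expander_fgl18b (dA dB : ℕ) (hA : 17 ≤ dA) (hB : 17 ≤ dB) :
    ∃ γ δ : ℝ, 0 < γ ∧ 0 < δ ∧ δ < 1 / 16 ∧
      ∀ n : ℕ, ∃ H : Matrix (Fin dA × Fin n) (Fin dB × Fin n) (ZMod 2),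
        Literature.InformationTheory.QuantumCodes.IsBiregular H dA dB ∧
        Literature.InformationTheory.QuantumCodes.IsLeftRightExpanding H dA dB γ δ γ δ := by
  have hA' : (17 : ℝ) ≤ dA := by exact_mod_cast hA
  have hB' : (17 : ℝ) ≤ dB := by exact_mod_cast hB
  obtain ⟨γ, hγ, h⟩ := exists_biregular_expander dA dB (2 / 33) (by nlinarith) (by nlinarith)
  exact ⟨γ, 2 / 33, hγ, by norm_num, by norm_num, h⟩

/-- ★ **The single-shot residual bound on an explicit-size quantum expander family.** For ALL `Δ_A, Δ_B ≥ 17` there are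
`γ > 0` and `0 < δ < 1/16` and, for every `n`, a `(Δ_A,Δ_B)`-biregular `(γ,δ,γ,δ)`-expander `H_n` (qubits
`(Fin Δ_B × Fin n)² ⊔ (Fin Δ_A × Fin n)²`) such that: for every threshold `κ` with `0 < κ` and `2κ < min Δ·(1 − 16δ)`, every
small-set-flip decoder `Dec` of `Q_{H_n}` with threshold `κ` (any tie-breaking), every qubit error `E` and every syndrome error
`D` with `max Δ·(|E| + (max Δ|E| + |D|)/κ) ≤ min Δ·min(γ n_A, γ n_B)`, the output `Ê = Dec(σ_X(E) ⊕ 𝟙_D)` leaves a residual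
`E ⊕ Ê` equivalent modulo `C_Z^⊥` to a word of weight `≤ 4|D|/(min Δ·(1 − 16δ) − 2κ)`; and the same for the other error type
(syndromes `expanderHZ`, corrections modulo `rowsp(expanderHX)`). (FGL18b Cor. 16 at `β = 2κ/min Δ`, packaged as
`ssfDecoder_residual_le_of_syndromeError` / `_zsector`, on the family `exists_biregular_expander_fgl18b`.)
[cite: FawziGrospellierLeverrier2018FT, Cor 16 (arXiv p0016 L97 – p0017 L14) with §2.3 Thm 4] -/
theorem exists_singleShot_family (dA dB : ℕ) (hA : 17 ≤ dA) (hB : 17 ≤ dB) :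
    ∃ (γ δ : ℝ), 0 < γ ∧ 0 < δ ∧ δ < 1 / 16 ∧
      ∀ n : ℕ, ∃ H : Matrix (Fin dA × Fin n) (Fin dB × Fin n) (ZMod 2),
        IsBiregular H dA dB ∧ IsLeftRightExpanding H dA dB γ δ γ δ ∧
        (∀ κ : ℝ, 0 < κ → 2 * κ < ((min dA dB : ℕ) : ℝ) * (1 - 16 * δ) →
          ∀ Dec : Decoder ((Fin dB × Fin n) × (Fin dA × Fin n) → ZMod 2)
            (((Fin dB × Fin n) × (Fin dB × Fin n)) ⊕ ((Fin dA × Fin n) × (Fin dA × Fin n)) → ZMod 2),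
          IsSSFDecoder κ (expanderHX H) (expanderHZ H) Dec →
          ∀ (e : ((Fin dB × Fin n) × (Fin dB × Fin n)) ⊕ ((Fin dA × Fin n) × (Fin dA × Fin n)) → ZMod 2)
            (D : Finset ((Fin dB × Fin n) × (Fin dA × Fin n))),
            ((max dA dB : ℕ) : ℝ) * (hammingNorm e + (((max dA dB : ℕ) : ℝ) * hammingNorm e + D.card) / κ)
                ≤ ((min dA dB : ℕ) : ℝ)
                  * min (γ * Fintype.card (Fin dB × Fin n)) (γ * Fintype.card (Fin dA × Fin n)) →
            ∃ e' : ((Fin dB × Fin n) × (Fin dB × Fin n)) ⊕ ((Fin dA × Fin n) × (Fin dA × Fin n)) → ZMod 2,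
              e' + (e + Dec (expanderHX H *ᵥ e + flipVec D)) ∈ rowSpace (expanderHZ H) ∧
              (hammingNorm e' : ℝ) ≤ 4 / (((min dA dB : ℕ) : ℝ) * (1 - 16 * δ) - 2 * κ) * D.card) ∧
        (∀ κ : ℝ, 0 < κ → 2 * κ < ((min dA dB : ℕ) : ℝ) * (1 - 16 * δ) →
          ∀ Dec : Decoder ((Fin dA × Fin n) × (Fin dB × Fin n) → ZMod 2)
            (((Fin dB × Fin n) × (Fin dB × Fin n)) ⊕ ((Fin dA × Fin n) × (Fin dA × Fin n)) → ZMod 2),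
          IsSSFDecoder κ (expanderHZ H) (expanderHX H) Dec →
          ∀ (e : ((Fin dB × Fin n) × (Fin dB × Fin n)) ⊕ ((Fin dA × Fin n) × (Fin dA × Fin n)) → ZMod 2)
            (D : Finset ((Fin dA × Fin n) × (Fin dB × Fin n))),
            ((max dA dB : ℕ) : ℝ) * (hammingNorm e + (((max dA dB : ℕ) : ℝ) * hammingNorm e + D.card) / κ)
                ≤ ((min dA dB : ℕ) : ℝ)
                  * min (γ * Fintype.card (Fin dB × Fin n)) (γ * Fintype.card (Fin dA × Fin n)) →
            ∃ e' : ((Fin dB × Fin n) × (Fin dB × Fin n)) ⊕ ((Fin dA × Fin n) × (Fin dA × Fin n)) → ZMod 2,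
              e' + (e + Dec (expanderHZ H *ᵥ e + flipVec D)) ∈ rowSpace (expanderHX H) ∧
              (hammingNorm e' : ℝ) ≤ 4 / (((min dA dB : ℕ) : ℝ) * (1 - 16 * δ) - 2 * κ) * D.card) := by
  obtain ⟨γ, δ, hγ, hδ, hδ', hfam⟩ := exists_biregular_expander_fgl18b dA dB hA hB
  have hdA : 0 < dA := by omega
  have hdB : 0 < dB := by omega
  have hmax : max δ δ = δ := max_self δ
  refine ⟨γ, δ, hγ, hδ, hδ', fun n => ?_⟩
  obtain ⟨H, hreg, hexp⟩ := hfam n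
  refine ⟨H, hreg, hexp, fun κ hκ0 hκ1 Dec hDec e D hsmall => ?_, fun κ hκ0 hκ1 Dec hDec e D hsmall => ?_⟩
  · have hκ1' : 2 * κ < ((min dA dB : ℕ) : ℝ) * (1 - 16 * max δ δ) := by rw [hmax]; exact hκ1
    have h := ssfDecoder_residual_le_of_syndromeError H hreg hexp hdA hdB hδ.le hδ.le hκ0 hκ1' Dec hDec e D hsmall
    rw [hmax] at h
    exact h
  · have hκ1' : 2 * κ < ((min dA dB : ℕ) : ℝ) * (1 - 16 * max δ δ) := by rw [hmax]; exact hκ1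
    have h := ssfDecoder_residual_le_of_syndromeError_zsector H hreg hexp hdA hdB hδ.le hδ.le hκ0 hκ1' Dec hDec
      e D hsmall
    rw [hmax] at h
    exact h

end Summit.Ventures.QEC.Expanders
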